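/-
Origin: expansion seat `planner-pub-hodgecm-prl1-g8-0`, handover REPLACE (DOC-ONLY v2; prl1-g6 HANDOVER #2 2026-08-18T12:55:06Z STATUS l.3771, re-hand prl1-g7 l.4148, r1-g25 G35 l.4137) md5 02efb00393c06835f4c8864eee8c4cd7 (444 l.) SUPERSEDES tree 9ee1e482 (= r27 df1cd660 + header) IN PLACE; comment-stripped residue md5 c25607ee identical to the tree copy (216 code lines: no declaration, statement or proof changed); imports unchanged (no rewrite); importers rec (`HOME/pub-hodgecm-prl1-g6/lean/Prl1g6/SignRecipe.lean`, md5 02efb003, 444 lines);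
landed by the gen-8 packager in gate run 31 REPLACES the earlier landed copy of `HodgeCM/Automorphic/SignRecipe.lean` (seat copy carried the packager origin header of the earlier run (stripped)).
-/
/-
Origin: HOME/pub-hodgecm-prl1-g5/lean/Prl1g5/SignRecipe.lean — session planner-pub-hodgecm-prl1-g5-0
(unit pub-hodgecm-prl1-g5, EXPANSION PROVER a-1 gen 5 on `Universe.RealisationExistsPerL / RealisationExistsFace`,
STRATEGY 1 = CONSTRUCT).  Intended final place: `HodgeCM/Automorphic/SignRecipe.lean`
(imports the tree module `HodgeCM.Automorphic.ThetaFacts` only).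
v2 (DOC-ONLY; session planner-pub-hodgecm-prl1-g6-0, unit pub-hodgecm-prl1-g6, gen 6): answers adversarial reader 1's
adv1g21-O7(a) / adv1g22-X48 item (2) / carries X50–X69 (GAPS.md ll. 6479, 6826, 8410, 8617): the normalisation `m(+) = -1`
stated the right way round, the `ι₁` sign `ε_hol` stated RELATIVE to the additive character (CITED-FACTS SPLIT-TWIST
(ID-5)), and the cover sentence (N1)/(N2) on which Weil theta models the recipe is PerL's forced sign.  No declaration,
statement or proof changed (same 400-line kernel content as md5 9ee1e482 of gate runs 27/28).
-/
import Summits.HodgeConjecture.HodgeCM.Automorphic.ThetaFacts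

/-!
# PerL's sign recipe `(κ, s)` CONSTRUCTED — the two DESIGN inputs of `ThetaModel.Inputs` discharged

`HodgeCM.Universe.ThetaModel` carries two pieces of SIGN DATA, so far free in every carrier of the realisation
cone (`ThetaCarrier.kappa/frameSign`, …, prl1-g4's `AdelicTorusCore.kappa/frameSign`) and constrained only by the
two DESIGN inputs `ThetaModel.Design_kappaConj`, `ThetaModel.Design_frameSignConj` of `HodgeCM.Automorphic.ThetaFacts`
("definitional constraint on the model's own datum, discharged by the instance, not by citation"):

* `kappa K L j ι₁ τ : K →+* ℂ` — the embedding of `K` deciding, through `ThetaModel.reqPos`, whether the line of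
  type `Ψ` must carry the frame sign or its opposite at `τ`;
* `frameSign L ι₁ τ : Bool` — the sign attached to ONE of the two embeddings over each real place of `L₀`.

This file BUILDS THE INSTANCE, verbatim from PerL v5 (paper-v5-d912a121.tex), and proves the two design
constraints as theorems (`SignRecipe.kappa_conjugate`, `SignRecipe.frameSign_conjugate`; packaged for any theta
model whose sign data are these in `ThetaModel.design_kappaConj_of_eq` / `design_frameSignConj_of_eq`), so that
downstream END STATES quantify over the EIGHT remaining inputs only (`ThetaModel.NonDesignInputs` =
2 PRINT + 6 OPEN, `NonDesignInputs.toInputs`).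

## The dictionary (PerL v5 §1.1, tex ll. 48–52, 61–65, 98–100; Lemma 3.3(a) ll. 280–284)

PerL fixes `L ⊂ ℚ̄ ⊂ ℂ`, "identif[ies] `Hom(L, ℂ) = 𝒢`, the inclusion corresponding to `1`" (l. 48–49) — in the
model the inclusion is `ι₁ : L →+* ℂ` and the embedding labelled `g ∈ 𝒢` is `ι₁ ∘ g` — and chooses "a
representative `ρ_b` … once and for all, with `ρ_{ι₁} = 1`" of every real place `b = {g_b, g_b c}` (ll. 51–52),
putting `m_b(Ψ) := -1` if `ρ_b ∈ Ψ`, `+1` if `ρ̄_b ∈ Ψ` (l. 53).  For a CM type `Φ_t ∋ φ₁` of `K = L^H`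
(eq:Psit, ll. 61–65) `Φ̃_t := {g ∈ 𝒢 : g|_K ∈ Φ_t}`, `Ψ_t^{(1)} := Φ̃_t⁻¹`, `Ψ_t^{(c)} := c Φ̃_t⁻¹`, i.e.
`ρ ∈ Ψ_t^{(φ^h)} ⟺ (ρ⁻¹ φ^h)|_K ∈ Φ_t` for the fixed `φ^h ∈ {1, c}` of (eq:Phiprime) l. 100 ([Y1neg] v2 Lemma 4.2:
`φ₁^h := φ₁` if `m_hol = -1`, `:= φ̄₁` if `m_hol = +1`).  Lemma 3.3(a) (l. 284): the real signs of an allowed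
`W_i` of type `Ψ_i` are forced, `s_b(W_i) = m⁻¹(m_b(Ψ_i))` for `b ≠ ι₁` and `s_{ι₁}(W_i) = ε_hol`, with
`m : {±} → {±1}`, `m(-s) = -m(s)` ([Y1neg] v2 Lemma 3.2; "we only use `|m| = 1` and `m(-s) = -m(s)`", l. 126 there).

MODEL (`ThetaModel.reqPos K L j ι₁ Ψ τ := if κ(τ) ∈ Ψ then s(τ) else ¬s(τ)`, `Ψ : CMType K` = `Φ_t`):
* `SignRecipe.kappa h K L j ι₁ (ι₁ ∘ g) := ι₁ ∘ g⁻¹ ∘ φ^h ∘ j` (`SignRecipe.kappa_of_gal`) — so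
  `κ(ι₁ ∘ ρ) ∈ Φ_t ⟺ (ρ⁻¹φ^h)|_K ∈ Φ_t ⟺ ρ ∈ Ψ_t^{(φ^h)} ⟺ m_{b(ρ)}(Ψ_t) = -1` when `ρ = ρ_b`; the bit
  `h : Bool` is `φ^h` (`false ↦ 1`, `true ↦ c`; the two recipes are complex conjugate on the orbit, `kappa_true_eq_conjugate`).
  At an embedding `τ` NOT of the form `ι₁ ∘ g` (impossible in PerL, where `L = K̃` is normal, and in rfwf, where
  `F` is Galois) the recipe restricts: `κ(τ) := τ ∘ j` (`kappa_of_not_gal`) — any conjugation-equivariant choice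
  is admissible there ("for a general pair `K →+* L` the model chooses any conjugation-equivariant recipe",
  `ThetaModel.Design_kappaConj` docstring).
* `SignRecipe.frameSign L ι₁ τ := (τ is the chosen representative of its place)`, the representatives being
  `R(L, ι₁) := {τ : Im τ(η_L) · Im ι₁(η_L) > 0}` for a fixed purely imaginary `η_L ∈ L^×` (`SignRecipe.eta`; the
  classical `Φ_η`): exactly one of `τ, τ̄` per place (`isRep_conjugate_iff`) and `ι₁ ∈ R` (`isRep_self`,
  PerL's "`ρ_{ι₁} = 1`"), read as `m(+) = -1`, i.e. `m⁻¹(-1) = +` AT THE REPRESENTATIVE (v2; v1 wrote "`m⁻¹(+1) = +`",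
  the opposite of what the code does — adv1g21-O7(a)) — so that, with `m_b(Ψ) = -1 ⟺ ρ_b ∈ Ψ` (tex l. 54),
  `reqPos` at `ρ_b` is `+` iff `κ(ρ_b) ∈ Φ_t` iff `ρ_b ∈ Ψ_t^{(φ^h)}` iff `m_b(Ψ_t) = -1 = m(+)`, which is Lemma 3.3(a)'s
  `s_b(W_i) = m⁻¹(m_b(Ψ_i))` exactly when `m(+) = -1` — the value of the STANDARD normalisation (N1) below, not a
  free choice of this file; and at `ι₁` it is the constant `ε_hol = s(ι₁)` (`frameSign_self`), `= +` RELATIVE TO the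
  additive character `ψ_{ι₁}` of the [Ad07, §2]-normalised Weil model (N2) — on PerL's four types `t^i_1 = +` and
  `κ(ι₁) = φ₁` for `h = false` (resp. the constant `-`, `κ(ι₁) = φ̄₁`, for `h = true`); PerL itself keeps `ε_hol`
  symbolic (tex ll. 283–285, 693), and the landed `HodgeCM.PerL34.FockPrintConjPlane` (`PlaneSign`,
  `kappaReachable_iff_of_data`) proves that a non-zero `κ`-vector exists at `ι₁` ONLY for the relative sign `pos` and
  winding number `α = -2`: `ε_hol = +` (relative to `ψ_{ι₁}`) and `h = false` are FORCED by the non-vacuity that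
  Def. 3.2 / `Open_occ` demand, not chosen.
WHAT IS A CONVENTION HERE (and is allowed to be, PerL l. 51 "chosen once and for all"; [Y1neg] l. 126 "we only
use `|m| = 1` and `m(-s) = -m(s)`" — notation only, neither text is cited as a fact): the element `η_L` (hence the
representative system) and the bit `h`.  Def 3.2 / Lemma 3.3 consume only "the forced signs" as a function of the
PLACE, which is what the two design theorems give (`HodgeCM.Proofs.RealisationConstruction.reqPos_conjugate`); the
construction of the seesaw datum with those signs (`HodgeCM.Proofs.SeesawConstruction`) works for every such function.

WHAT IS A NORMALISATION, NOT A CONVENTION OF THE RECIPE (v2; adv1g21-O7(b), adv1g22-X48; print: CITED-FACTS.md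
SPLIT-TWIST (ID-5), gen-4 row (definite `b`) and `ι₁` ROW — J. Adams, *The theta correspondence over ℝ*, in *Harmonic
Analysis, Group Representations, Automorphic Forms and Invariant Theory* (World Sci. 2007), Prop. 6.6 (held text
`book:li2007-harmonic-analysis-group-representations-automorphic-forms-invariant` chunk p0023 L20–22: the constants of
the Fock model have weight `((m-n)/2,…)` for the `det^*` covers), and M. Harris, *Cohomological automorphic forms on
unitary groups II*, same volume pp. 89–149, (2.3.3)–(2.3.4) (chunks p0107 L29–p0108 L7: `τ′ = τ̃′ + ½ α(χ′)(1,…,1)`);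
also HKS96 (1.5)–(1.8), J. Amer. Math. Soc. 9 (1996) p. 951).  The identity "`ThetaModel.SignsForced` for THIS
recipe = PerL's forced signs of Lemma 3.3(a)" holds for a Weil theta model whose archimedean components are normalised
as follows, and FLIPS at any real place where `ψ_b` (or the identification `L_{w_b} ≅ ℂ`) is conjugated:
(N1) at every `b ≠ ι₁` the identification `L_{w_b} ≅ ℂ` is made through the `η_L`-REPRESENTATIVE `ρ_b` (`IsRep`) and
  `ψ_b`, `χ_{V,b}` are the standard ones for that orientation (adv1g21-O7(b): PerL l. 259's trace-zero `δ` taken in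
  the class of `η_L` modulo totally positive elements of `L₀` — or the equivalent statement in the model's own terms),
  so that in the model of a POSITIVE line the vacuum character of `U(3)` is `det^{(α+1)/2}` and `𝟏_{U(3)}` occurs
  iff `α = m_b(Ψ_i) = -1 ⟺ ρ_b ∈ Ψ_i` — this is `m(+) = -1`;
(N2) at `ι₁` the complex structure of `𝔹²` is the one with `𝔭₊ ≅ V⁺ ⊗ (V⁻)^∨` and the sign of `W_{ι₁}` is read
  RELATIVE to `ψ_{ι₁}` (`HodgeCM.PerL34.FockPrintConjPlane`: "`pos ↔ sign W_{ι₁} = sign ψ_{ι₁}`"); there the vacuum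
  of a line is `(0,0;-1)` iff `α = -1 ⟺ ρ_{ι₁} ∈ Ψ_i`, and `κ = (1,1;-2)` is reachable only for `(pos, α = -2)`
  (`FockPrintConjPlane.kappaReachable_iff_of_data`) — pairing `ε_hol = +` with `h = false` (`φ^h = φ₁`, `m_hol = -1`).
COVER SENTENCE for dischargers (adv1g21-O7 item (2)): every Weil theta model `wm` over which the OPEN inputs
`Open_thetaSub` / `Open_thetaWedge` / `Open_thetaGen12` / `Open_thetaReal34` / `Open_chars` / `Open_occ` of a theta
model carrying THIS recipe (`HodgeCM.Automorphic.SignRecipeEndState`: `AdelicThetaCore.wm`, `AdelicThetaCore.thetaModel`,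
`thetaModel_kappa/frameSign = SignRecipe.kappa/frameSign` by `rfl`) are to be discharged must have its archimedean
components normalised by (N1)–(N2); for such `wm`, `GoodCtx.forced` IS PerL's forced sign.  The recipe's VALUES agree
with that normalisation (adv1g22-X48: "not a wrong-value objection"); nothing in this file asserts (N1)–(N2) — they are
the dictionary under which its two design theorems mean what PerL's Lemma 3.3(a) says.

Kernel facts used: Mathlib's `NumberField.IsCMField.complexConj` (every complex embedding of a CM field
intertwines it with complex conjugation, `IsCMField.complexEmbedding_complexConj`; it is not the identity,
`IsCMField.complexConj_ne_one`), whence: complex conjugation COMMUTES with every ring automorphism of `L`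
(`SignRecipe.ringEquiv_map_conj` — the centrality of `c` in `𝒢`, PerL l. 47 "complex conjugation `c ∈ 𝒢` is
central", here a theorem for every CM field), and an automorphism `g` with `ι₁ ∘ g = τ` is unique
(`SignRecipe.gal_unique`).  Axioms: the Lean trio only.
-/

noncomputable section

open NumberField NumberField.ComplexEmbedding
open scoped ComplexConjugate

namespace HodgeCM

namespace SignRecipe

open Literature.AlgebraicGeometry.ShimuraVarieties (conjRingHomK embedding_conjRingHomK)

/-! ## 1. A purely imaginary generator `η_L` and the representative system `R(L, ι₁)` -/

section Eta

variable (L : CMField)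

/-- (Ported verbatim from the HodgeCMPerL package; no docstring in the source.) -/
theorem conjRingHomK_apply (x : L) : conjRingHomK L x = IsCMField.complexConj L x := rfl

/-- Complex conjugation of a CM field moves some element. -/
theorem exists_conj_ne : ∃ x : L, conjRingHomK L x ≠ x := by
  by_contra h
  simp only [not_exists, not_not] at h
  exact IsCMField.complexConj_ne_one L (AlgEquiv.ext fun x => by
    rw [AlgEquiv.one_apply]; exact h x)

/-- A fixed element of `L` moved by complex conjugation. -/
def xi : L := (exists_conj_ne L).choose

/-- (Ported verbatim from the HodgeCMPerL package; no docstring in the source.) -/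
theorem conj_xi_ne : conjRingHomK L (xi L) ≠ xi L := (exists_conj_ne L).choose_spec

/-- `η_L := ξ - ξ̄`: a fixed nonzero purely imaginary element of the CM field `L`. -/
def eta : L := xi L - conjRingHomK L (xi L)

/-- (Ported verbatim from the HodgeCMPerL package; no docstring in the source.) -/
theorem conj_eta : conjRingHomK L (eta L) = -eta L := by
  simp only [eta, map_sub, conjRingHomK_apply, IsCMField.complexConj_apply_apply]
  ring

/-- (Ported verbatim from the HodgeCMPerL package; no docstring in the source.) -/
theorem embedding_eta (τ : L →+* ℂ) : τ (eta L) = τ (xi L) - conj (τ (xi L)) := by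
  unfold eta
  rw [map_sub, embedding_conjRingHomK]

/-- (Ported verbatim from the HodgeCMPerL package; no docstring in the source.) -/
theorem embedding_eta_re (τ : L →+* ℂ) : (τ (eta L)).re = 0 := by
  rw [embedding_eta, Complex.sub_re, Complex.conj_re, sub_self]

/-- (Ported verbatim from the HodgeCMPerL package; no docstring in the source.) -/
theorem embedding_eta_im (τ : L →+* ℂ) : (τ (eta L)).im = 2 * (τ (xi L)).im := by
  rw [embedding_eta, Complex.sub_im, Complex.conj_im]
  ring

/-- `Im τ(η_L) ≠ 0` at every complex embedding. -/
theorem embedding_eta_im_ne_zero (τ : L →+* ℂ) : (τ (eta L)).im ≠ 0 := by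
  rw [embedding_eta_im]
  intro h
  have him : (τ (xi L)).im = 0 := by
    rcases mul_eq_zero.mp h with h2 | h2
    · exact absurd h2 two_ne_zero
    · exact h2
  apply conj_xi_ne L
  apply τ.injective
  rw [embedding_conjRingHomK]
  exact Complex.conj_eq_iff_im.mpr him

/-- (Ported verbatim from the HodgeCMPerL package; no docstring in the source.) -/
theorem eta_ne_zero : eta L ≠ 0 := by
  intro h
  obtain ⟨τ⟩ := (inferInstance : Nonempty (L →+* ℂ))
  have := embedding_eta_im_ne_zero L τ
  rw [h, map_zero, Complex.zero_im] at this
  exact this rfl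

/-- (Ported verbatim from the HodgeCMPerL package; no docstring in the source.) -/
theorem conjugate_eta_im (τ : L →+* ℂ) : ((conjugate τ) (eta L)).im = -(τ (eta L)).im := by
  rw [conjugate_coe_eq, Complex.conj_im]

/-- **PerL's representatives** (v5 l. 51–52: "a representative `ρ_b` is chosen once and for all, with
`ρ_{ι₁} = 1`"): `τ` is THE representative of its place iff `Im τ(η_L)` has the sign of `Im ι₁(η_L)`. -/
def IsRep (ι₁ τ : L →+* ℂ) : Prop := 0 < (τ (eta L)).im * (ι₁ (eta L)).im

/-- `ρ_{ι₁} = 1`: the distinguished embedding is its own representative. -/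
theorem isRep_self (ι₁ : L →+* ℂ) : IsRep L ι₁ ι₁ :=
  mul_self_pos.mpr (embedding_eta_im_ne_zero L ι₁)

/-- Exactly one of `τ, τ̄` is a representative. -/
theorem isRep_conjugate_iff (ι₁ τ : L →+* ℂ) : IsRep L ι₁ (conjugate τ) ↔ ¬IsRep L ι₁ τ := by
  unfold IsRep
  rw [conjugate_eta_im, neg_mul]
  have hne : (τ (eta L)).im * (ι₁ (eta L)).im ≠ 0 :=
    mul_ne_zero (embedding_eta_im_ne_zero L τ) (embedding_eta_im_ne_zero L ι₁)
  constructor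
  · intro h h'
    linarith
  · intro h
    rcases lt_or_gt_of_ne hne with hlt | hgt
    · linarith
    · exact absurd hgt h

end Eta

/-! ## 2. The frame sign `s` -/

section FrameSign

variable (L : CMField)

open scoped Classical in
/-- **PerL's frame sign** `s(τ)`: `true` (= `+`, = `m⁻¹(-1)` in the standard normalisation `m(+) = -1` of the
module docstring's (N1), read at the representative; v1's "`m⁻¹(+1)`, `m(+) = +1`" was the wrong way round,
adv1g21-O7(a)) iff `τ` is the representative of its place (§1).  At `ι₁` this is `ε_hol` (`frameSign_self`), `= +`
RELATIVE to the additive character `ψ_{ι₁}` in the normalisation (N2) (CITED-FACTS SPLIT-TWIST (ID-5) `ι₁` row;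
`HodgeCM.PerL34.FockPrintConjPlane.kappaReachable_iff_of_data`: forced, not chosen). -/
def frameSign (L : CMField) (ι₁ τ : L →+* ℂ) : Bool := decide (IsRep L ι₁ τ)

/-- (Ported verbatim from the HodgeCMPerL package; no docstring in the source.) -/
theorem frameSign_eq_true_iff (ι₁ τ : L →+* ℂ) : frameSign L ι₁ τ = true ↔ IsRep L ι₁ τ := by
  classical
  simp [frameSign]

/-- `s(ι₁) = +` (`ρ_{ι₁} = 1`; [BMM] Cor. 7.9 `(a,b) = (1,0)`). -/
theorem frameSign_self (ι₁ : L →+* ℂ) : frameSign L ι₁ ι₁ = true :=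
  (frameSign_eq_true_iff L ι₁ ι₁).mpr (isRep_self L ι₁)

/-- **DESIGN constraint `Design_frameSignConj`, proved:** the frame sign flips at the conjugate embedding. -/
theorem frameSign_conjugate (ι₁ τ : L →+* ℂ) :
    frameSign L ι₁ (conjugate τ) = !(frameSign L ι₁ τ) := by
  classical
  by_cases h : IsRep L ι₁ τ
  · have h' : ¬IsRep L ι₁ (conjugate τ) := fun h' => (isRep_conjugate_iff L ι₁ τ).mp h' h
    simp [frameSign, h, h']
  · have h' : IsRep L ι₁ (conjugate τ) := (isRep_conjugate_iff L ι₁ τ).mpr h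
    simp [frameSign, h, h']

end FrameSign

/-! ## 3. The type recipe `κ` -/

section Kappa

variable (K L : CMField)

/-- **Complex conjugation is central:** it commutes with every ring automorphism of the CM field `L`
(PerL v5 l. 47; here for every CM field, from `IsCMField.complexEmbedding_complexConj` at the two embeddings
`ι, ι ∘ g`). -/
theorem ringEquiv_map_conj (g : L ≃+* L) (x : L) : g (conjRingHomK L x) = conjRingHomK L (g x) := by
  obtain ⟨ι⟩ := (inferInstance : Nonempty (L →+* ℂ))
  apply ι.injective
  have h1 := embedding_conjRingHomK L (ι.comp g.toRingHom) x
  simp only [RingHom.coe_comp, Function.comp_apply, RingEquiv.toRingHom_eq_coe, RingHom.coe_coe] at h1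
  rw [h1, embedding_conjRingHomK]

/-- Complex conjugation of `L` as a ring automorphism. -/
def conjEquiv : L ≃+* L := (IsCMField.complexConj L).toRingEquiv

/-- (Ported verbatim from the HodgeCMPerL package; no docstring in the source.) -/
@[simp] theorem conjEquiv_apply (x : L) : conjEquiv L x = conjRingHomK L x := rfl

/-- (Ported verbatim from the HodgeCMPerL package; no docstring in the source.) -/
@[simp] theorem conjEquiv_symm_apply (x : L) : (conjEquiv L).symm x = conjRingHomK L x := by
  rw [RingEquiv.symm_apply_eq, conjEquiv_apply, conjRingHomK_apply, conjRingHomK_apply,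
    IsCMField.complexConj_apply_apply]

/-- `ι₁ ∘ (c ∘ g) = \overline{ι₁ ∘ g}`. -/
theorem comp_trans_conjEquiv (ι₁ : L →+* ℂ) (g : L ≃+* L) :
    ι₁.comp (g.trans (conjEquiv L)).toRingHom = conjugate (ι₁.comp g.toRingHom) := by
  ext x
  simp only [RingHom.coe_comp, Function.comp_apply, RingEquiv.toRingHom_eq_coe, RingHom.coe_coe,
    RingEquiv.coe_trans, conjEquiv_apply, conjugate_coe_eq]
  exact embedding_conjRingHomK L ι₁ (g x)

/-- An automorphism `g` with `ι₁ ∘ g = τ` is unique (PerL's identification `Hom(L, ℂ) = 𝒢`, l. 48). -/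
theorem gal_unique {ι₁ τ : L →+* ℂ} {g g' : L ≃+* L} (hg : ι₁.comp g.toRingHom = τ)
    (hg' : ι₁.comp g'.toRingHom = τ) : g = g' := by
  apply RingEquiv.ext
  intro x
  apply ι₁.injective
  have h := congrArg (fun f : L →+* ℂ => f x) (hg.trans hg'.symm)
  simpa using h

/-- `φ^h ∈ {1, c}` ((eq:Phiprime) l. 100; [Y1neg] v2 Lemma 4.2): `false ↦ 1`, `true ↦ c`. -/
def phiH (L : CMField) : Bool → (L →+* L)
  | false => RingHom.id L
  | true => conjRingHomK L

/-- (Ported verbatim from the HodgeCMPerL package; no docstring in the source.) -/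
@[simp] theorem phiH_false : phiH L false = RingHom.id L := rfl
/-- (Ported verbatim from the HodgeCMPerL package; no docstring in the source.) -/
@[simp] theorem phiH_true : phiH L true = conjRingHomK L := rfl

/-- (Ported verbatim from the HodgeCMPerL package; no docstring in the source.) -/
theorem ringEquiv_map_phiH (h : Bool) (g : L ≃+* L) (x : L) : g (phiH L h x) = phiH L h (g x) := by
  cases h
  · rfl
  · exact ringEquiv_map_conj L g x

/-- (Ported verbatim from the HodgeCMPerL package; no docstring in the source.) -/
theorem embedding_phiH (h : Bool) (ι : L →+* ℂ) (x : L) :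
    ι (phiH L h x) = if h then conj (ι x) else ι x := by
  cases h
  · rfl
  · exact embedding_conjRingHomK L ι x

open scoped Classical in
/-- **PerL's type recipe `κ`** ((eq:Psit), tex ll. 61–65, with `φ^h` of l. 100): at an embedding `τ = ι₁ ∘ g`,
`g ∈ Aut(L)` (unique, `gal_unique`), `κ(τ) := ι₁ ∘ g⁻¹ ∘ φ^h ∘ j : K →+* ℂ` — the embedding `(g⁻¹φ^h)|_K` read in
`ℂ` through the fixed inclusion `ι₁`; at an embedding not of this form (none when `L/ℚ` is normal) the recipe
restricts, `κ(τ) := τ ∘ j`. -/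
def kappa (h : Bool) (K L : CMField) (j : K →+* L) (ι₁ τ : L →+* ℂ) : K →+* ℂ :=
  if H : ∃ g : L ≃+* L, ι₁.comp g.toRingHom = τ then
    ((ι₁.comp H.choose.symm.toRingHom).comp (phiH L h)).comp j
  else τ.comp j

variable {K L}

/-- **(eq:Psit) verbatim:** `κ(ι₁ ∘ g) = ι₁ ∘ g⁻¹ ∘ φ^h ∘ j`. -/
theorem kappa_of_gal (h : Bool) (j : K →+* L) {ι₁ τ : L →+* ℂ} (g : L ≃+* L)
    (hg : ι₁.comp g.toRingHom = τ) :
    kappa h K L j ι₁ τ = ((ι₁.comp g.symm.toRingHom).comp (phiH L h)).comp j := by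
  have H : ∃ g : L ≃+* L, ι₁.comp g.toRingHom = τ := ⟨g, hg⟩
  have e : H.choose = g := gal_unique L H.choose_spec hg
  unfold kappa
  rw [dif_pos H, e]

/-- (Ported verbatim from the HodgeCMPerL package; no docstring in the source.) -/
theorem kappa_of_gal_apply (h : Bool) (j : K →+* L) {ι₁ τ : L →+* ℂ} (g : L ≃+* L)
    (hg : ι₁.comp g.toRingHom = τ) (x : K) :
    kappa h K L j ι₁ τ x = ι₁ (g.symm (phiH L h (j x))) := by
  rw [kappa_of_gal h j g hg]
  simp

/-- Off the automorphism orbit of `ι₁` the recipe restricts. -/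
theorem kappa_of_not_gal (h : Bool) (j : K →+* L) {ι₁ τ : L →+* ℂ}
    (hτ : ¬∃ g : L ≃+* L, ι₁.comp g.toRingHom = τ) : kappa h K L j ι₁ τ = τ.comp j := by
  unfold kappa
  rw [dif_neg hτ]

/-- `κ(ι₁) = φ₁ := ι₁ ∘ j` for `φ^h = 1` (PerL l. 49 `φ₁ := 1|_K`; so `κ(ι₁) ∈ Φ_t` for all four `t^i`, `t^i_1 = +`). -/
theorem kappa_self_false (j : K →+* L) (ι₁ : L →+* ℂ) : kappa false K L j ι₁ ι₁ = ι₁.comp j := by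
  rw [kappa_of_gal false j (RingEquiv.refl L) (by ext; simp)]
  ext x
  simp

/-- `κ(ι₁) = φ̄₁` for `φ^h = c`. -/
theorem kappa_self_true (j : K →+* L) (ι₁ : L →+* ℂ) :
    kappa true K L j ι₁ ι₁ = conjugate (ι₁.comp j) := by
  rw [kappa_of_gal true j (RingEquiv.refl L) (by ext; simp)]
  ext x
  simp only [RingHom.coe_comp, Function.comp_apply, RingEquiv.toRingHom_eq_coe, RingHom.coe_coe,
    RingEquiv.symm_refl, RingEquiv.refl_apply, phiH_true, conjugate_coe_eq]
  exact embedding_conjRingHomK L ι₁ (j x)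

/-- The two recipes `φ^h = 1, c` are complex conjugate on the automorphism orbit of `ι₁`:
`κ^{(c)}(ι₁ ∘ g) = \overline{κ^{(1)}(ι₁ ∘ g)}` (`Ψ_t^{(c)} = c Ψ_t^{(1)}`, (eq:Psit)). -/
theorem kappa_true_eq_conjugate (j : K →+* L) {ι₁ τ : L →+* ℂ} (g : L ≃+* L)
    (hg : ι₁.comp g.toRingHom = τ) :
    kappa true K L j ι₁ τ = conjugate (kappa false K L j ι₁ τ) := by
  ext x
  rw [kappa_of_gal_apply true j g hg, conjugate_coe_eq, kappa_of_gal_apply false j g hg, phiH_true,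
    phiH_false, RingHom.id_apply, ← embedding_conjRingHomK, ringEquiv_map_conj]

/-- **DESIGN constraint `Design_kappaConj`, proved:** `κ(τ̄) = \overline{κ(τ)}` — for `τ = ι₁ ∘ g` this is the
centrality of `c` (`(cg)⁻¹φ^h = c · g⁻¹φ^h`, `ringEquiv_map_conj`), elsewhere it is `\overline{τ ∘ j} = τ̄ ∘ j`. -/
theorem kappa_conjugate (h : Bool) (j : K →+* L) (ι₁ τ : L →+* ℂ) :
    kappa h K L j ι₁ (conjugate τ) = conjugate (kappa h K L j ι₁ τ) := by
  by_cases H : ∃ g : L ≃+* L, ι₁.comp g.toRingHom = τ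
  · obtain ⟨g, hg⟩ := H
    have hg' : ι₁.comp (g.trans (conjEquiv L)).toRingHom = conjugate τ := by
      rw [comp_trans_conjEquiv, hg]
    ext x
    rw [kappa_of_gal_apply h j _ hg', conjugate_coe_eq, kappa_of_gal_apply h j g hg,
      RingEquiv.symm_trans_apply, conjEquiv_symm_apply, ringEquiv_map_conj, embedding_conjRingHomK]
  · have H' : ¬∃ g : L ≃+* L, ι₁.comp g.toRingHom = conjugate τ := by
      rintro ⟨g, hg⟩
      refine H ⟨g.trans (conjEquiv L), ?_⟩
      rw [comp_trans_conjEquiv, hg]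
      exact involutive_conjugate L τ
    rw [kappa_of_not_gal h j H', kappa_of_not_gal h j H, conjugate_comp]

end Kappa


-- port_pkg: scope closed for this part
end SignRecipe
end HodgeCM
end
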